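import Literature.GroupTheory.LocallyConstantCochainTransport

/-!
# Transport of locally constant `2`-cochains between subgroups `S ≤ Γ` and `S' ≤ Γ'` along `S ≃ₜ* S'`

Topic `GroupTheory` (profinite groups, explicit cochains); namespace
`Literature.GroupTheory.LocallyConstantCocycles`.  Proof file: theorems only (no definition, no
instance, no named fact); Mathlib + `LocallyConstantCochainTransport.lean` only.

CONVENTIONS as in `LocallyConstantCocyclesClosedSubgroups.lean` / `NeukirchAbstractUniqueness.lean`
(abc-iut-w5-d055): a cochain "on `S`" is a total function `f : Γ → Γ → R` read on `S × S`
(locally constant there; cocycle / coboundary identities quantified over `S`; coefficients `R` with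
trivial action).  `LocallyConstantCochainTransport.lean` moves TOTAL cochains on a topological group
`H` to cochains on a subgroup `S ≤ Γ` along `H ≃ₜ* S`.  This sequel is the SUBGROUP-TO-SUBGROUP form
every instantiation step of Neukirch's lemma uses ([NSW] (12.1.9): level transport along
`Gal(K̄/K_V) ≅ V ≤ Γ_ℚ`, `α`-transport `D_A ∩ W ↦ α(D_A ∩ W)`, local transport `Γ_{K_v} ⊇ U ↦ D_A ∩ W`):
given `e : S ≃ₜ* S'` between subgroups `S ≤ Γ`, `S' ≤ Γ'`,

* `exists_cochainOn_of_cochainOn` — push a cochain lc/cocycle on `S` to one lc/cocycle on `S'`,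
  agreeing through `e`;
* `coboundaryOn_push` / `coboundaryOn_pull` — coboundaries on `S` and on `S'` correspond (for cochains
  agreeing through `e`);
* `exists_cocycleOn_not_coboundaryOn_of_equiv` — "`H² ≠ 0`" moves from `S` to `S'`;
* `sub_mul_coboundaryOn_of_equiv` — "`dim H² ≤ 1`" (every cocycle is `c • f` plus a coboundary) moves
  from `S` to `S'`;
* `exists_continuousMulEquiv_subgroupOfMap` — for `α : U₁ ≃ₜ* U₂` (`Uᵢ` subgroups) and `C ≤ U₁`, the
  isomorphism `C ≃ₜ* α(C)` over `α` (`α(C)` read back in the ambient group);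
* `exists_continuousMulEquiv_mapOfEquiv` — for `e₀ : H ≃ₜ* V` (`V` a subgroup) and `D ≤ H`, the
  isomorphism `D ≃ₜ* e₀(D)` over `e₀`.

## References

* J.-P. Serre, *Galois Cohomology* (1997), I §2.2. [SerreGaloisCohomology1997]
* J. Neukirch, A. Schmidt, K. Wingberg, *Cohomology of Number Fields* (2008), XII §1 (12.1.9).
  [NeukirchSchmidtWingberg2008]
-/

open Topology Function

universe u v w x

namespace Literature.GroupTheory.LocallyConstantCocycles

section SubgroupToSubgroup

variable {Γ : Type u} [Group Γ] [TopologicalSpace Γ]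
variable {Γ' : Type v} [Group Γ'] [TopologicalSpace Γ']
variable {R : Type w} [AddCommGroup R]

/-- A cochain locally constant on `S` which agrees with `β' : S → R` — extension by zero; used to
return from cochains on the subtype `↥S` to the "total function read on `S`" convention.
[cite: SerreGaloisCohomology1997, I §2.2] -/
theorem exists_total_of_subtype (S : Subgroup Γ) (β' : S → R) (hβ' : IsLocallyConstant β') :
    ∃ β : Γ → R, IsLocallyConstant (fun s : S => β s) ∧ ∀ s : S, β s = β' s := by
  classical
  refine ⟨fun x => if h : x ∈ S then β' ⟨x, h⟩ else 0, ?_, fun s => by simp⟩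
  have heq : (fun s : S => (fun x => if h : x ∈ S then β' ⟨x, h⟩ else 0) (s : Γ)) = β' := by
    funext s; simp
  rw [heq]
  exact hβ'

/-- **Push a cochain from `S` to `S'` along `e : S ≃ₜ* S'`**: a cochain `f : Γ → Γ → R` locally
constant and a `2`-cocycle on `S` yields `f' : Γ' → Γ' → R` locally constant and a `2`-cocycle on
`S'` with `f' (e a) (e b) = f a b` (`a b ∈ S`). [cite: SerreGaloisCohomology1997, I §2.2] -/
theorem exists_cochainOn_of_cochainOn (S : Subgroup Γ) (S' : Subgroup Γ') (e : S ≃ₜ* S')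
    (f : Γ → Γ → R) (hlc : IsLocallyConstant (fun x : S × S => f x.1 x.2))
    (hcoc : ∀ a ∈ S, ∀ b ∈ S, ∀ c ∈ S, f a b + f (a * b) c = f b c + f a (b * c)) :
    ∃ f' : Γ' → Γ' → R,
      IsLocallyConstant (fun x : S' × S' => f' x.1 x.2) ∧
      (∀ a ∈ S', ∀ b ∈ S', ∀ c ∈ S', f' a b + f' (a * b) c = f' b c + f' a (b * c)) ∧
      ∀ a b : S, f' (e a) (e b) = f a b :=
  exists_cochainOn_of_cochain S' e (fun a b : S => f a b) hlc (fun a b c => by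
    have := hcoc _ a.2 _ b.2 _ c.2
    rwa [← Subgroup.coe_mul, ← Subgroup.coe_mul] at this)

/-- **Coboundaries push forward along `e : S ≃ₜ* S'`** (for cochains agreeing through `e`).
[cite: SerreGaloisCohomology1997, I §2.2] -/
theorem coboundaryOn_push (S : Subgroup Γ) (S' : Subgroup Γ') (e : S ≃ₜ* S')
    {f : Γ → Γ → R} {f' : Γ' → Γ' → R} (hfe : ∀ a b : S, f' (e a) (e b) = f a b)
    (h : ∃ β : Γ → R, IsLocallyConstant (fun s : S => β s) ∧
      ∀ a ∈ S, ∀ b ∈ S, f a b = β a + β b - β (a * b)) :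
    ∃ β' : Γ' → R, IsLocallyConstant (fun s : S' => β' s) ∧
      ∀ a ∈ S', ∀ b ∈ S', f' a b = β' a + β' b - β' (a * b) := by
  obtain ⟨β, hβ, hcob⟩ := h
  exact coboundaryOn_of_coboundary S' e (d := fun a b : S => f a b) hfe (β' := fun s : S => β s) hβ
    (fun a b => by
      have := hcob _ a.2 _ b.2
      rwa [← Subgroup.coe_mul] at this)

/-- **Coboundaries pull back along `e : S ≃ₜ* S'`** (for cochains agreeing through `e`).
[cite: SerreGaloisCohomology1997, I §2.2] -/
theorem coboundaryOn_pull (S : Subgroup Γ) (S' : Subgroup Γ') (e : S ≃ₜ* S')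
    {f : Γ → Γ → R} {f' : Γ' → Γ' → R} (hfe : ∀ a b : S, f' (e a) (e b) = f a b)
    (h : ∃ β' : Γ' → R, IsLocallyConstant (fun s : S' => β' s) ∧
      ∀ a ∈ S', ∀ b ∈ S', f' a b = β' a + β' b - β' (a * b)) :
    ∃ β : Γ → R, IsLocallyConstant (fun s : S => β s) ∧
      ∀ a ∈ S, ∀ b ∈ S, f a b = β a + β b - β (a * b) := by
  obtain ⟨β', hβ', hcob'⟩ := h
  obtain ⟨β₀, hβ₀, hd⟩ := coboundary_of_coboundaryOn S' e (d := fun a b : S => f a b) hfe hβ' hcob'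
  obtain ⟨β, hβ, hββ₀⟩ := exists_total_of_subtype S β₀ hβ₀
  refine ⟨β, hβ, fun a ha b hb => ?_⟩
  have := hd ⟨a, ha⟩ ⟨b, hb⟩
  rw [← hββ₀, ← hββ₀, ← hββ₀ (⟨a, ha⟩ * ⟨b, hb⟩)] at this
  exact this

/-- **"`H²(S, R) ≠ 0`" moves along `e : S ≃ₜ* S'`**: if some cochain is lc and a cocycle on `S` and
not a coboundary on `S`, the same holds on `S'`. [cite: NeukirchSchmidtWingberg2008, XII §1 (12.1.9)] -/
theorem exists_cocycleOn_not_coboundaryOn_of_equiv (S : Subgroup Γ) (S' : Subgroup Γ') (e : S ≃ₜ* S')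
    (h : ∃ f : Γ → Γ → R, IsLocallyConstant (fun x : S × S => f x.1 x.2) ∧
      (∀ a ∈ S, ∀ b ∈ S, ∀ c ∈ S, f a b + f (a * b) c = f b c + f a (b * c)) ∧
      ¬ ∃ β : Γ → R, IsLocallyConstant (fun s : S => β s) ∧
        ∀ a ∈ S, ∀ b ∈ S, f a b = β a + β b - β (a * b)) :
    ∃ f' : Γ' → Γ' → R, IsLocallyConstant (fun x : S' × S' => f' x.1 x.2) ∧
      (∀ a ∈ S', ∀ b ∈ S', ∀ c ∈ S', f' a b + f' (a * b) c = f' b c + f' a (b * c)) ∧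
      ¬ ∃ β' : Γ' → R, IsLocallyConstant (fun s : S' => β' s) ∧
        ∀ a ∈ S', ∀ b ∈ S', f' a b = β' a + β' b - β' (a * b) := by
  obtain ⟨f, hlc, hcoc, hf⟩ := h
  obtain ⟨f', hlc', hcoc', hfe⟩ := exists_cochainOn_of_cochainOn S S' e f hlc hcoc
  exact ⟨f', hlc', hcoc', fun h' => hf (coboundaryOn_pull S S' e hfe h')⟩

/-- **"`dim H²(S, R) ≤ 1`" moves along `e : S ≃ₜ* S'`** (`R` a commutative ring): if on `S` every
lc cocycle is `c • f` plus a coboundary for any non-cobounding lc cocycle `f`, then the same holds on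
`S'`. [cite: NeukirchSchmidtWingberg2008, XII §1 (12.1.9)] -/
theorem sub_mul_coboundaryOn_of_equiv {R : Type w} [CommRing R] (S : Subgroup Γ) (S' : Subgroup Γ')
    (e : S ≃ₜ* S')
    (h : ∀ f g : Γ → Γ → R, IsLocallyConstant (fun x : S × S => f x.1 x.2) →
      (∀ a ∈ S, ∀ b ∈ S, ∀ c ∈ S, f a b + f (a * b) c = f b c + f a (b * c)) →
      IsLocallyConstant (fun x : S × S => g x.1 x.2) →
      (∀ a ∈ S, ∀ b ∈ S, ∀ c ∈ S, g a b + g (a * b) c = g b c + g a (b * c)) →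
      (¬ ∃ β : Γ → R, IsLocallyConstant (fun s : S => β s) ∧
        ∀ a ∈ S, ∀ b ∈ S, f a b = β a + β b - β (a * b)) →
      ∃ c : R, ∃ β : Γ → R, IsLocallyConstant (fun s : S => β s) ∧
        ∀ a ∈ S, ∀ b ∈ S, g a b - c * f a b = β a + β b - β (a * b))
    (f' g' : Γ' → Γ' → R) (hflc : IsLocallyConstant (fun x : S' × S' => f' x.1 x.2))
    (hfcoc : ∀ a ∈ S', ∀ b ∈ S', ∀ c ∈ S', f' a b + f' (a * b) c = f' b c + f' a (b * c))
    (hglc : IsLocallyConstant (fun x : S' × S' => g' x.1 x.2))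
    (hgcoc : ∀ a ∈ S', ∀ b ∈ S', ∀ c ∈ S', g' a b + g' (a * b) c = g' b c + g' a (b * c))
    (hf : ¬ ∃ β' : Γ' → R, IsLocallyConstant (fun s : S' => β' s) ∧
      ∀ a ∈ S', ∀ b ∈ S', f' a b = β' a + β' b - β' (a * b)) :
    ∃ c : R, ∃ β' : Γ' → R, IsLocallyConstant (fun s : S' => β' s) ∧
      ∀ a ∈ S', ∀ b ∈ S', g' a b - c * f' a b = β' a + β' b - β' (a * b) := by
  -- pull `f'`, `g'` back to `S` along `e.symm`
  obtain ⟨f, hflc₀, hfcoc₀, hfe⟩ := exists_cochainOn_of_cochainOn S' S e.symm f' hflc hfcoc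
  obtain ⟨g, hglc₀, hgcoc₀, hge⟩ := exists_cochainOn_of_cochainOn S' S e.symm g' hglc hgcoc
  -- they agree with `f'`, `g'` through `e`
  have hfe' : ∀ a b : S, f' (e a) (e b) = f a b := fun a b => by
    have := hfe (e a) (e b); rw [e.symm_apply_apply, e.symm_apply_apply] at this; exact this.symm
  have hge' : ∀ a b : S, g' (e a) (e b) = g a b := fun a b => by
    have := hge (e a) (e b); rw [e.symm_apply_apply, e.symm_apply_apply] at this; exact this.symm
  have hf₀ : ¬ ∃ β : Γ → R, IsLocallyConstant (fun s : S => β s) ∧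
      ∀ a ∈ S, ∀ b ∈ S, f a b = β a + β b - β (a * b) :=
    fun h' => hf (coboundaryOn_push S S' e hfe' h')
  obtain ⟨c, hc⟩ := h f g hflc₀ hfcoc₀ hglc₀ hgcoc₀ hf₀
  refine ⟨c, coboundaryOn_push S S' e (f := fun x y => g x y - c * f x y)
    (f' := fun x y => g' x y - c * f' x y) (fun a b => by simp only [hfe', hge']) hc⟩

end SubgroupToSubgroup

/-! ### Two constructors of `S ≃ₜ* S'` -/

section Constructors

variable {Γ : Type u} [Group Γ] [TopologicalSpace Γ]
variable {Γ' : Type v} [Group Γ'] [TopologicalSpace Γ']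

/-- **`C ≃ₜ* α(C)` over `α : U₁ ≃ₜ* U₂`**: for subgroups `U₁ ≤ Γ`, `U₂ ≤ Γ'`, an isomorphism of
topological groups `α : U₁ ≃ₜ* U₂` and a subgroup `C ≤ U₁` (given as a subgroup of `Γ`), the image
`α(C) = ((C.subgroupOf U₁).map α).map U₂.subtype ≤ Γ'` is isomorphic to `C` over `α`
(the `α`-transport of Neukirch's lemma, [NSW] XII §2). [cite: NeukirchSchmidtWingberg2008, XII §1 (12.1.9)] -/
theorem exists_continuousMulEquiv_subgroupOfMap (U₁ : Subgroup Γ) (U₂ : Subgroup Γ') (α : U₁ ≃ₜ* U₂)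
    (C : Subgroup Γ) (hC : C ≤ U₁) :
    ∃ e : C ≃ₜ* (((C.subgroupOf U₁).map α.toMonoidHom).map U₂.subtype),
      ∀ c : C, ((e c : ((C.subgroupOf U₁).map α.toMonoidHom).map U₂.subtype) : Γ') =
        ((α ⟨c, hC c.2⟩ : U₂) : Γ') := by
  set T : Subgroup Γ' := ((C.subgroupOf U₁).map α.toMonoidHom).map U₂.subtype with hT
  have hmem : ∀ c : C, ((α ⟨c, hC c.2⟩ : U₂) : Γ') ∈ T := fun c =>
    ⟨α ⟨c, hC c.2⟩, ⟨⟨c, hC c.2⟩, by exact Subgroup.mem_subgroupOf.mpr c.2, rfl⟩, rfl⟩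
  -- every element of `T` is `α c` for a unique `c ∈ C`
  have hT' : ∀ t : T, ∃ c : C, ((α ⟨c, hC c.2⟩ : U₂) : Γ') = t := by
    rintro ⟨t, ht⟩
    obtain ⟨u₂, ⟨u₁, hu₁, rfl⟩, rfl⟩ := ht
    have hu₁' : (u₁ : Γ) ∈ C := Subgroup.mem_subgroupOf.mp hu₁
    exact ⟨⟨u₁, hu₁'⟩, rfl⟩
  let toFun : C → T := fun c => ⟨_, hmem c⟩
  have hto_cont : Continuous toFun := by
    apply Continuous.subtype_mk
    exact continuous_subtype_val.comp (α.continuous.comp (Continuous.subtype_mk continuous_subtype_val _))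
  -- the inverse: `t ↦ α⁻¹ ⟨t, _⟩`, with `t ∈ U₂`
  have hTU₂ : ∀ t : T, (t : Γ') ∈ U₂ := by
    rintro ⟨t, u₂, -, rfl⟩; exact u₂.2
  have hinvC : ∀ t : T, ((α.symm ⟨t, hTU₂ t⟩ : U₁) : Γ) ∈ C := by
    intro t
    obtain ⟨c, hc⟩ := hT' t
    have : (⟨(t : Γ'), hTU₂ t⟩ : U₂) = α ⟨c, hC c.2⟩ := Subtype.ext hc.symm
    rw [this, α.symm_apply_apply]
    exact c.2
  let invFun : T → C := fun t => ⟨_, hinvC t⟩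
  have hinv_cont : Continuous invFun := by
    apply Continuous.subtype_mk
    exact continuous_subtype_val.comp (α.symm.continuous.comp (Continuous.subtype_mk continuous_subtype_val _))
  have hleft : ∀ c, invFun (toFun c) = c := fun c => by
    apply Subtype.ext
    change ((α.symm ⟨((α ⟨c, hC c.2⟩ : U₂) : Γ'), _⟩ : U₁) : Γ) = c
    have : (⟨((α ⟨c, hC c.2⟩ : U₂) : Γ'), hTU₂ (toFun c)⟩ : U₂) = α ⟨c, hC c.2⟩ := Subtype.ext rfl
    rw [this, α.symm_apply_apply]
  have hright : ∀ t, toFun (invFun t) = t := fun t => by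
    apply Subtype.ext
    obtain ⟨c, hc⟩ := hT' t
    change ((α ⟨((α.symm ⟨(t : Γ'), hTU₂ t⟩ : U₁) : Γ), _⟩ : U₂) : Γ') = t
    have : (⟨((α.symm ⟨(t : Γ'), hTU₂ t⟩ : U₁) : Γ), hC (hinvC t)⟩ : U₁) = α.symm ⟨(t : Γ'), hTU₂ t⟩ :=
      Subtype.ext rfl
    rw [this, α.apply_symm_apply]
  refine ⟨{ toFun := toFun, invFun := invFun, left_inv := hleft, right_inv := hright,
            map_mul' := fun a b => ?_, continuous_toFun := hto_cont, continuous_invFun := hinv_cont },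
    fun c => rfl⟩
  apply Subtype.ext
  change ((α ⟨((a * b : C) : Γ), _⟩ : U₂) : Γ') = ((α ⟨a, _⟩ : U₂) : Γ') * ((α ⟨b, _⟩ : U₂) : Γ')
  rw [← Subgroup.coe_mul, ← map_mul]
  rfl

/-- **`D ≃ₜ* e₀(D)` over `e₀ : H ≃ₜ* V`**: for a topological group `H`, a subgroup `V ≤ Γ'`, an
isomorphism `e₀ : H ≃ₜ* V` and a subgroup `D ≤ H`, the image `e₀(D) = (D.map e₀).map V.subtype ≤ Γ'`
is isomorphic to `D` over `e₀` (the level transport `Gal(K̄/K_V) ≅ V ≤ Γ_ℚ` of Neukirch's lemma).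
[cite: NeukirchSchmidtWingberg2008, XII §1 (12.1.9)] -/
theorem exists_continuousMulEquiv_mapOfEquiv {H : Type x} [Group H] [TopologicalSpace H]
    (V : Subgroup Γ') (e₀ : H ≃ₜ* V) (D : Subgroup H) :
    ∃ e : D ≃ₜ* ((D.map e₀.toMonoidHom).map V.subtype),
      ∀ d : D, ((e d : (D.map e₀.toMonoidHom).map V.subtype) : Γ') = ((e₀ d : V) : Γ') := by
  -- `D ≤ ⊤` and `e₀` viewed as `⊤ ≃ₜ* V`: reduce to the previous constructor
  let α : (⊤ : Subgroup H) ≃ₜ* V :=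
    { (Subgroup.topEquiv : (⊤ : Subgroup H) ≃* H).trans e₀.toMulEquiv with
      continuous_toFun := e₀.continuous.comp continuous_subtype_val
      continuous_invFun := by
        apply Continuous.subtype_mk
        exact e₀.symm.continuous }
  obtain ⟨e, he⟩ := exists_continuousMulEquiv_subgroupOfMap (⊤ : Subgroup H) V α D le_top
  have hT : ((D.subgroupOf ⊤).map α.toMonoidHom).map V.subtype = (D.map e₀.toMonoidHom).map V.subtype := by
    ext y
    simp only [Subgroup.mem_map, Subgroup.mem_subgroupOf]
    constructor
    · rintro ⟨v, ⟨d, hd, rfl⟩, rfl⟩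
      exact ⟨e₀ d, ⟨(d : H), hd, rfl⟩, rfl⟩
    · rintro ⟨v, ⟨d, hd, rfl⟩, rfl⟩
      exact ⟨α ⟨d, trivial⟩, ⟨⟨d, trivial⟩, hd, rfl⟩, rfl⟩
  rw [← hT]
  exact ⟨e, fun d => he d⟩

end Constructors

end Literature.GroupTheory.LocallyConstantCocycles
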